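import Literature.Computability.Complexity.ClayProblem
import Literature.Computability.Complexity.TimeBoundsProofs
import Literature.Computability.Complexity.TM2Simulation
import Literature.Computability.Complexity.Transducers
import Literature.Computability.Complexity.CoinTruncation
import HarnessLib

/-!
# P versus NP (`pnp`): the model bridge `Literature.PNP.NP Bool = CplxCore.NP`

`ClayProblem.lean` states the named fact `Literature.Computability.Complexity.NP_bool_eq`: Cook's checking-relation form of
`NP` over the alphabet `{0, 1, #}` (`Literature.PNP.NP Bool` of `PNPWave0.lean`: `L ∈ NP` iff
`w ∈ L ↔ ∃ y, |y| ≤ |w| ^ k ∧ R w y` for a relation `R` with `{w # y | R w y} ∈ P (Option Bool)`;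
Cook, Clay problem description, §1) equals the certificate form over `{0, 1}`
(`CplxCore.NP = polyExists P`: `x ∈ L ↔ ∃ y, |y| ≤ p |x| ∧ boolPair x y ∈ L'`, `L' ∈ P`;
Arora–Barak 2009, Def. 2.1). Neither source proves this: it is part of the folklore
robustness of the model (Arora–Barak §1.2–1.3; the alphabets differ, Claim 1.5, and the
certificate bounds differ, `|x| ^ k` versus `p(|x|)`). Both sides are Mathlib's `Turing.FinTM2`
in polynomial time, so an actual proof needs machines; this file gives it (`np_bool_eq`),
assembling tools of the tree — `Transducers.lean` (finite-state transductions),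
`TM2Simulation.lean` (the flag wrapper `PolyTimeComputable.flagElim`), `CoinTruncation.lean`
(truncation `⟨x, y⟩ ↦ ⟨x, y ↾ p(|x|)⟩` is polynomial-time, on top of `UnaryArithMachines.lean`
and `TM2Iterate.lean`) and `TimeBoundsProofs.lean` (composition) — with two new transducers:

* `NP_bool_subset : Literature.PNP.NP Bool ⊆ CplxCore.NP`. Given `R`, `k`, take
  `L' = {boolPair x y | R x y}` and `p = X ^ k`; `L' ∈ P` because its indicator is the given
  decider composed with the transducer `unpairFST` (`boolPair x y ↦ pairWord x y`, malformed
  words `↦ []`).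
* `NP_subset_NP_bool : CplxCore.NP ⊆ Literature.PNP.NP Bool`. Given `L' ∈ P` and `p`, choose `k`
  with `p n ≤ n ^ k` for `n ≥ 2` (`exists_pow_dominates`) and the checking relation
  `R x y := if |x| ≤ 1 then (y = [] ∧ x ∈ L) else boolPair x (y ↾ p |x|) ∈ L'` — the
  certificate is *truncated* to the allowed length instead of being measured, so that no
  comparison machine is needed, and the finitely many `x` with `|x| ≤ 1`, where `|x| ^ k` and
  `p |x|` disagree, are hard-wired. Its language `{pairWord x y | R x y}` is decided by
  `relDecider`: the transducer `pairFST` (parse `pairWord`, decide the short cases,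
  flag-encode the payload as `true :: boolPair x y`), then, under `flagElim`, the truncation
  machine followed by the decider of `L'`.
* `np_bool_eq : Literature.PNP.NP Bool = CplxCore.NP`; the discharge `NP_bool_eq_holds` of the named
  fact is the one-line corollary in `ClayProblemProofs.lean`.

## Design notes

* The functions computed by the transducers on *all* words (not only code words) matter on
  the `id`-encoded side; hence the dichotomy lemmas `unpairFST_eval_dichotomy`,
  `pairFST_eval_dichotomy` and the classical parser `sSmall`.
* The flag presentation `TM2Lift.flagEncode (uncurry boolPair)` (`inl b ↦ [false, b]`,
  `inr (x, y) ↦ true :: boolPair x y`) agrees pointwise with the sum encoding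
  `Computability.Encoding.sumBool` of `BoolEncodings.lean` (tag `false` = `inl`); it is used
  in the form required by `flagElim`.
* `PolyTimeComputable.precomp` / `.of_output_eq` are the two bookkeeping steps (same
  machine, re-indexed input / re-presented output) used to move between `id`-coded words and
  pair-coded arguments.
* Relation to the hand-built pairing machines of the tree: `PairFstTM`
  (`NondeterministicProofs.lean`, `z ↦ (boolUnpair z).1`) and `RePairTM`
  (`PairingMachines.lean`, the normaliser `boolPair ∘ boolUnpair`, `polyTimeComputable_boolUnpair`)
  stay inside the alphabet `{0, 1}`; the two transductions needed here change the alphabet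
  (`boolPair x y ↦ pairWord x y` over `{0, 1, ‖}` and back, with the short cases and the flag
  presentation folded in), so they are obtained as instances (`unpairFST`, `pairFST`) of the
  generic transducer machine `FST` of `Transducers.lean` rather than by adapting those machines.

## References

* S. Cook, *The P versus NP problem*, Clay Mathematics Institute (2000), §1 (checking
  relations, `|y| ≤ |w|^k`).
* S. Arora, B. Barak, *Computational Complexity: A Modern Approach*, CUP 2009, Def. 2.1
  (p. 39: NP via certificates `u ∈ {0,1}^{p(|x|)}`), §1.2–1.3 (robustness of the model),
  Claim 1.5 (alphabet reduction `{0,1,#} → {0,1}` costs a constant factor).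
-/

/-! ## Transducers for the NP bridge -/

namespace Literature.Computability.Complexity

open _root_.Computability TM2Lift

/-! ### `pairWord` API -/

/-- `pairWord` is injective in both arguments. [folklore] -/
theorem pairWord_injective {Γ : Type} {w y w' y' : List Γ}
    (h : pairWord w y = pairWord w' y') : w = w' ∧ y = y' := by
  induction w generalizing w' with
  | nil =>
    cases w' with
    | nil =>
      simp only [pairWord, List.map_nil, List.nil_append, List.cons.injEq, true_and] at h
      exact ⟨rfl, List.map_injective_iff.2 (Option.some_injective _) h⟩
    | cons a w' => simp [pairWord] at h
  | cons a w ih =>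
    cases w' with
    | nil => simp [pairWord] at h
    | cons a' w' =>
      simp only [pairWord, List.map_cons, List.cons_append, List.cons.injEq, Option.some.injEq] at h
      obtain ⟨rfl, h⟩ := h
      obtain ⟨h1, h2⟩ := ih h
      exact ⟨by rw [h1], h2⟩

/-- `pairWord w y` is never empty (it contains the separator). [folklore] -/
theorem pairWord_ne_nil {Γ : Type} (w y : List Γ) : pairWord w y ≠ [] := by
  cases w <;> simp [pairWord]

/-- Length of `pairWord w y`. [folklore] -/
theorem length_pairWord {Γ : Type} (w y : List Γ) :
    (pairWord w y).length = w.length + y.length + 1 := by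
  simp [pairWord]; omega

/-! ### transducer 1: `boolPair x y ↦ pairWord x y` -/

/-- States of the `boolPair`-parser. [folklore] -/
inductive UnpairSt
  | first          -- expecting the first bit of a pair
  | second (b : Bool)  -- read the first bit `b` of a pair
  | copy           -- separator seen, copying `y`
  | dead           -- malformed input
  deriving DecidableEq

/-- finiteness, by enumeration [folklore] -/
instance : Fintype UnpairSt :=
  ⟨{.first, .second true, .second false, .copy, .dead}, by
    intro x; rcases x with _ | ⟨_ | _⟩ | _ | _ <;> simp⟩

/-- Transition function of `unpairFST`. [folklore] -/
def unpairStep : UnpairSt → Bool → UnpairSt × List (Option Bool)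
  | .first, b => (.second b, [])
  | .second b, b' =>
    if b = b' then (.first, [some b]) else if b' then (.copy, [none]) else (.dead, [])
  | .copy, c => (.copy, [some c])
  | .dead, _ => (.dead, [])

/-- The transducer reading `boolPair x y` and writing `pairWord x y`; on words that are not of
this form the body is discarded (output `[]`). [folklore] -/
def unpairFST : FST UnpairSt Bool (Option Bool) where
  init := .first
  step := unpairStep
  front _ := []
  keep s := decide (s = .copy)

/-- unfolding [folklore] -/
@[simp] theorem unpairFST_step : unpairFST.step = unpairStep := rfl
/-- unfolding [folklore] -/
@[simp] theorem unpairFST_init : unpairFST.init = .first := rfl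
/-- unfolding [folklore] -/
@[simp] theorem unpairFST_front (s : UnpairSt) : unpairFST.front s = [] := rfl
/-- unfolding [folklore] -/
@[simp] theorem unpairFST_keep (s : UnpairSt) : unpairFST.keep s = decide (s = .copy) := rfl

/-- In copy mode the transducer copies. [folklore] -/
theorem unpairFST_run_copy (y : List Bool) :
    unpairFST.run .copy y = (.copy, y.map some) := by
  induction y with
  | nil => rfl
  | cons c y ih => simp [FST.run_cons, unpairStep, ih]

/-- The dead state is absorbing. [folklore] -/
theorem unpairFST_run_dead (v : List Bool) : (unpairFST.run .dead v).1 = .dead := by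
  induction v with
  | nil => rfl
  | cons c v ih => simpa [FST.run_cons, unpairStep] using ih

/-- Run of `unpairFST` on a code word `boolPair x y`. [folklore] -/
theorem unpairFST_run_boolPair (x y : List Bool) :
    unpairFST.run .first (boolPair x y) = (.copy, pairWord x y) := by
  induction x with
  | nil => simp [boolPair, pairWord, unpairStep, unpairFST_run_copy, FST.run_cons]
  | cons b x ih =>
    have : boolPair (b :: x) y = b :: b :: boolPair x y := by simp [boolPair]
    rw [this, FST.run_cons, FST.run_cons]
    simp [unpairStep, ih, pairWord]

/-- `unpairFST` maps `boolPair x y` to `pairWord x y`. [folklore] -/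
theorem unpairFST_eval_boolPair (x y : List Bool) :
    unpairFST.eval (boolPair x y) = pairWord x y := by
  simp [FST.eval, unpairFST_run_boolPair]

/-- Key dichotomy: either the input is a `boolPair` code word (and the output is the
corresponding `pairWord`), or the output is empty. [folklore] -/
theorem unpairFST_eval_dichotomy (v : List Bool) :
    (∃ x y, v = boolPair x y) ∨ unpairFST.eval v = [] := by
  suffices h : ∀ n (v : List Bool), v.length ≤ n → (unpairFST.run .first v).1 = .copy →
      ∃ x y, v = boolPair x y by
    by_cases hc : (unpairFST.run .first v).1 = .copy
    · exact Or.inl (h _ v le_rfl hc)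
    · right; simp [FST.eval, hc]
  intro n
  induction n using Nat.strong_induction_on with
  | _ n ih =>
    intro v hv hc
    match v, hv, hc with
    | [], _, hc => simp at hc
    | [b], _, hc => simp [FST.run_cons, unpairStep] at hc
    | b :: b' :: rest, hv, hc =>
      by_cases hbb : b = b'
      · subst hbb
        have hc' : (unpairFST.run .first rest).1 = .copy := by
          simpa [FST.run_cons, unpairStep] using hc
        obtain ⟨x, y, rfl⟩ := ih rest.length (by simp at hv; omega) rest le_rfl hc'
        exact ⟨b :: x, y, by simp [boolPair]⟩
      · cases b' with
        | true =>
          cases b with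
          | true => exact absurd rfl hbb
          | false => exact ⟨[], rest, by simp [boolPair]⟩
        | false =>
          have : (unpairFST.run .first (b :: false :: rest)).1 = .dead := by
            simp [FST.run_cons, unpairStep, hbb, unpairFST_run_dead]
          rw [this] at hc; cases hc

/-! ### transducer 2: `pairWord x y ↦` flagged `boolPair x y`, with the small cases decided -/

section Small

variable (tbl : List Bool → Bool)

/-- States of the `pairWord`-parser with a two-symbol look-ahead on `x`. [folklore] -/
inductive PairSt
  | x0                      -- nothing read
  | x1 (a : Bool)           -- one `x`-symbol read (buffered)
  | xn                      -- at least two `x`-symbols read (emitted)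
  | ys (ox : Option Bool)   -- separator seen after `≤ 1` symbols `ox`; `y` empty so far
  | ysn                     -- separator seen after `≤ 1` symbols; `y` nonempty
  | yb                      -- separator seen after `≥ 2` symbols; copying `y`
  | dead                    -- a second separator: malformed
  deriving DecidableEq

/-- finiteness, by enumeration [folklore] -/
instance : Fintype PairSt :=
  ⟨{.x0, .x1 true, .x1 false, .xn, .ys none, .ys (some true), .ys (some false), .ysn, .yb, .dead},
    by intro x; rcases x with _ | ⟨_ | _⟩ | _ | ⟨_ | _ | _⟩ | _ | _ | _ <;> simp⟩

/-- Transition function of `pairFST`. [folklore] -/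
def pairStep : PairSt → Option Bool → PairSt × List Bool
  | .x0, some a => (.x1 a, [])
  | .x0, none => (.ys none, [])
  | .x1 a, some b => (.xn, [a, a, b, b])
  | .x1 a, none => (.ys (some a), [])
  | .xn, some b => (.xn, [b, b])
  | .xn, none => (.yb, [false, true])
  | .ys _, some _ => (.ysn, [])
  | .ys _, none => (.dead, [])
  | .ysn, some _ => (.ysn, [])
  | .ysn, none => (.dead, [])
  | .yb, some c => (.yb, [c])
  | .yb, none => (.dead, [])
  | .dead, _ => (.dead, [])

/-- Final word of `pairFST`: the flag, and for short `x` the hard-wired answer. [folklore] -/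
def pairFront : PairSt → List Bool
  | .yb => [true]
  | .ys ox => [false, tbl ox.toList]
  | _ => [false, false]

/-- The transducer for direction `CplxCore.NP ⊆ PNP.NP`: on `pairWord x y` with `2 ≤ |x|` it
writes `true :: boolPair x y`; with `|x| ≤ 1` it writes `[false, tbl x && y.isEmpty]`-style
answers (`tbl` is the hard-wired membership table for the finitely many short `x`); on
malformed words it writes `[false, false]`. [folklore] -/
def pairFST : FST PairSt (Option Bool) Bool where
  init := .x0
  step := pairStep
  front := pairFront tbl
  keep s := decide (s = .yb)

/-- unfolding [folklore] -/
@[simp] theorem pairFST_step : (pairFST tbl).step = pairStep := rfl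
/-- unfolding [folklore] -/
@[simp] theorem pairFST_init : (pairFST tbl).init = .x0 := rfl
/-- unfolding [folklore] -/
@[simp] theorem pairFST_front : (pairFST tbl).front = pairFront tbl := rfl
/-- unfolding [folklore] -/
@[simp] theorem pairFST_keep (s : PairSt) : (pairFST tbl).keep s = decide (s = .yb) := rfl

/-- In state `yb` the transducer copies `y`. [folklore] -/
theorem pairFST_run_yb (y : List Bool) : (pairFST tbl).run .yb (y.map some) = (.yb, y) := by
  induction y with
  | nil => rfl
  | cons c y ih => simp [FST.run_cons, pairStep, ih]

/-- From state `xn`, the run on `pairWord x y` emits `boolPair x y` (doubled `x`, separator,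
`y`). [folklore] -/
theorem pairFST_run_xn (x y : List Bool) :
    (pairFST tbl).run .xn (pairWord x y) = (.yb, (x.flatMap fun b => [b, b]) ++ [false, true] ++ y) := by
  induction x with
  | nil => simp [pairWord, FST.run_cons, pairStep, pairFST_run_yb]
  | cons b x ih =>
    have : pairWord (b :: x) y = some b :: pairWord x y := by simp [pairWord]
    rw [this, FST.run_cons]
    simp [pairStep, ih]

/-- In state `ysn` nothing is emitted. [folklore] -/
theorem pairFST_run_ysn (y : List Bool) : (pairFST tbl).run .ysn (y.map some) = (.ysn, []) := by
  induction y with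
  | nil => rfl
  | cons d y ih => simp [FST.run_cons, pairStep, ih]

/-- Output on `pairWord x y` with `2 ≤ |x|`. [folklore] -/
theorem pairFST_eval_big (x y : List Bool) (hx : 2 ≤ x.length) :
    (pairFST tbl).eval (pairWord x y) = true :: boolPair x y := by
  match x, hx with
  | a :: b :: x, _ =>
    have : pairWord (a :: b :: x) y = some a :: some b :: pairWord x y := by simp [pairWord]
    simp [FST.eval, this, FST.run_cons, pairStep, pairFST_run_xn, boolPair, pairFront]

/-- Output on `pairWord x y` with `|x| ≤ 1`. [folklore] -/
theorem pairFST_eval_small (x y : List Bool) (hx : x.length ≤ 1) :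
    (pairFST tbl).eval (pairWord x y) = [false, tbl x && y.isEmpty] := by
  match x, hx, y with
  | [], _, [] => simp [FST.eval, pairWord, FST.run_cons, pairStep, pairFront]
  | [], _, c :: y =>
    have hw : pairWord [] (c :: y) = none :: some c :: y.map some := by simp [pairWord]
    simp [FST.eval, hw, FST.run_cons, pairStep, pairFront, pairFST_run_ysn]
  | [a], _, [] => simp [FST.eval, pairWord, FST.run_cons, pairStep, pairFront]
  | [a], _, c :: y =>
    have hw : pairWord [a] (c :: y) = some a :: none :: some c :: y.map some := by
      simp [pairWord]
    simp [FST.eval, hw, FST.run_cons, pairStep, pairFront, pairFST_run_ysn]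

end Small

end Literature.Computability.Complexity

/-! ## The NP bridge: assembly -/

namespace Literature.Computability.Complexity

open Turing _root_.Computability Polynomial

/-! ### small closure properties of `PolyTimeComputable` -/

/-- Reindexing the input along any map (same machine). [folklore] -/
theorem PolyTimeComputable.precomp {α α' β Γ₀ Γ₁ : Type} {ea : α → List Γ₀}
    {eb : β → List Γ₁} {f : α → β} (h : PolyTimeComputable ea eb f) (g : α' → α) :
    PolyTimeComputable (ea ∘ g) eb (f ∘ g) := by
  obtain ⟨p, M, hM⟩ := h
  exact ⟨p, M, fun a => hM (g a)⟩

/-- Changing the output presentation without changing the output words (same machine).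
[folklore] -/
theorem PolyTimeComputable.of_output_eq {α β β' Γ₀ Γ₁ : Type} {ea : α → List Γ₀}
    {eb : β → List Γ₁} {eb' : β' → List Γ₁} {f : α → β} {f' : α → β'}
    (h : PolyTimeComputable ea eb f) (he : ∀ a, eb' (f' a) = eb (f a)) :
    PolyTimeComputable ea eb' f' := by
  obtain ⟨p, M, hM⟩ := h
  refine ⟨p, M, fun a => ?_⟩
  have := hM a
  simp only at this ⊢
  rw [he a]
  exact this

/-! ### polynomials are dominated by powers beyond `1` -/

/-- Every `ℕ`-polynomial is dominated by a single power `n ^ k` (`k ≥ 1`) for all `n ≥ 2`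
(from the tree's `exists_eval_le_mul_pow_add`: `c n^j + c ≤ 2 n^(c+j) ≤ n^(c+j+1)`). [folklore] -/
theorem exists_pow_dominates (p : Polynomial ℕ) :
    ∃ k : ℕ, 1 ≤ k ∧ ∀ n : ℕ, 2 ≤ n → p.eval n ≤ n ^ k := by
  obtain ⟨c, k, h⟩ := exists_eval_le_mul_pow_add p
  refine ⟨c + k + 1, by omega, fun n hn => (h n).trans ?_⟩
  have hc : c ≤ n ^ c := (Nat.lt_two_pow_self).le.trans (Nat.pow_le_pow_left hn c)
  have h1 : c * n ^ k + c ≤ n ^ c * n ^ k + n ^ c * n ^ k := by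
    have h2 : n ^ c ≤ n ^ c * n ^ k := Nat.le_mul_of_pos_right _ (Nat.pow_pos (by omega))
    have h3 : c * n ^ k ≤ n ^ c * n ^ k := Nat.mul_le_mul_right _ hc
    omega
  calc c * n ^ k + c ≤ 2 * n ^ (c + k) := by rw [pow_add]; omega
    _ ≤ n * n ^ (c + k) := Nat.mul_le_mul_right _ hn
    _ = n ^ (c + k + 1) := by ring

end Literature.Computability.Complexity

namespace Literature.Computability.Complexity

open _root_.Computability Turing Polynomial TM2Lift

/-! ### direction `PNP.NP Bool ⊆ CplxCore.NP` -/

/-- Decoding `boolPair x y ↦ pairWord x y` is polynomial-time (the transducer `unpairFST`). [folklore] -/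
theorem polyTimeComputable_unpair :
    PolyTimeComputable (Function.uncurry boolPair)
      (fun q : List Bool × List Bool => pairWord q.1 q.2) id :=
  ((FST.polyTimeComputable_eval unpairFST).precomp (Function.uncurry boolPair)).of_output_eq
    (by rintro ⟨x, y⟩; simp [unpairFST_eval_boolPair])

/-- Cook's checking-relation `NP` over `{0,1,#}` (Cook, Clay problem description §1) is
contained in `polyExists P` over `{0,1}` (Arora–Barak 2009, Def. 2.1).
[cite: AroraBarakCC2009, Def. 2.1 (book p. 39)] -/
theorem NP_bool_subset : Literature.Computability.Complexity.PNPWave0.NP Bool ⊆ Nondeterministic.NP := by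
  rintro L ⟨k, R, ⟨f, hf, hS⟩, hL⟩
  rw [isPolyTimePred_iff] at hf
  set L' : Language Bool := {v | ∃ x y, v = boolPair x y ∧ R x y} with hL'def
  have hmem : ∀ x y, boolPair x y ∈ L' ↔ R x y := fun x y =>
    ⟨fun ⟨x', y', h, h'⟩ => by
        obtain ⟨rfl, rfl⟩ := Prod.mk.inj (boolPair_injective (a₁ := (x, y)) (a₂ := (x', y')) h)
        exact h',
      fun h => ⟨x, y, rfl, h⟩⟩
  have hfS : ∀ x y, f (pairWord x y) = true ↔ R x y := fun x y => by
    rw [← hS]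
    exact ⟨fun ⟨x', y', h, h'⟩ => by obtain ⟨rfl, rfl⟩ := pairWord_injective h; exact h',
      fun h => ⟨x, y, rfl, h⟩⟩
  have hind : L'.boolIndicator = f ∘ unpairFST.eval := by
    funext v
    rcases unpairFST_eval_dichotomy v with ⟨x, y, rfl⟩ | hv
    · rw [Function.comp_apply, unpairFST_eval_boolPair]
      by_cases hR : R x y
      · rw [(Set.mem_iff_boolIndicator _ _).1 ((hmem x y).2 hR), ((hfS x y).2 hR)]
      · rw [(Set.notMem_iff_boolIndicator _ _).1 (fun h => hR ((hmem x y).1 h))]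
        exact (Bool.eq_false_iff.2 (fun h => hR ((hfS x y).1 h))).symm
    · rw [Function.comp_apply, hv]
      have h1 : v ∉ L' := by
        rintro ⟨x, y, rfl, -⟩
        rw [unpairFST_eval_boolPair] at hv
        exact pairWord_ne_nil _ _ hv
      rw [(Set.notMem_iff_boolIndicator _ _).1 h1]
      symm
      rw [Bool.eq_false_iff]
      intro h
      obtain ⟨x, y, h, -⟩ := (hS _).2 h
      exact pairWord_ne_nil _ _ h.symm
  have hcomp : PolyTimeComputable (id : List Bool → List Bool) encodeBool L'.boolIndicator := by
    rw [hind]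
    exact PolyTimeComputable.comp_holds hf (FST.polyTimeComputable_eval unpairFST)
  have hL'P : L' ∈ Classes.P := mem_P_iff_holds.2 (polyTimeDecidable_iff.2 hcomp)
  refine ⟨L', hL'P, X ^ k, fun x => ?_⟩
  simp only [eval_pow, eval_X, hmem]
  exact hL x

/-! ### direction `CplxCore.NP ⊆ PNP.NP Bool` -/

section Converse

variable (tbl : List Bool → Bool)

/-- The first stage of the checking-relation decider, as a function: parse `pairWord x y`,
decide the short cases `|x| ≤ 1` by the table, pass long ones on. [folklore] -/
noncomputable def sSmall (u : List (Option Bool)) : Bool ⊕ (List Bool × List Bool) :=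
  haveI := Classical.dec
  if h : ∃ q : List Bool × List Bool, u = pairWord q.1 q.2 then
    (if (Classical.choose h).1.length ≤ 1 then
      Sum.inl (tbl (Classical.choose h).1 && (Classical.choose h).2.isEmpty)
    else Sum.inr (Classical.choose h))
  else Sum.inl false

/-- `sSmall` on a `pairWord`. [folklore] -/
theorem sSmall_pairWord (x y : List Bool) :
    sSmall tbl (pairWord x y) =
      if x.length ≤ 1 then Sum.inl (tbl x && y.isEmpty) else Sum.inr (x, y) := by
  unfold sSmall
  have h : ∃ q : List Bool × List Bool, pairWord x y = pairWord q.1 q.2 := ⟨(x, y), rfl⟩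
  rw [dif_pos h]
  have hq : Classical.choose h = (x, y) := by
    have := Classical.choose_spec h
    obtain ⟨h1, h2⟩ := pairWord_injective this
    ext <;> simp [← h1, ← h2]
  rw [hq]
  by_cases hx : x.length ≤ 1 <;> simp [hx]

/-- `sSmall` on a malformed word answers `false`. [folklore] -/
theorem sSmall_of_not (u : List (Option Bool)) (hu : ¬ ∃ x y, u = pairWord x y) :
    sSmall tbl u = Sum.inl false := by
  unfold sSmall
  rw [dif_neg]
  rintro ⟨q, hq⟩
  exact hu ⟨q.1, q.2, hq⟩

/-- words with no separator are `y.map some` [folklore] -/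
theorem exists_map_some_of_forall {v : List (Option Bool)} (h : ∀ o ∈ v, o ≠ none) :
    ∃ y : List Bool, v = y.map some := by
  induction v with
  | nil => exact ⟨[], rfl⟩
  | cons o v ih =>
    obtain ⟨y, rfl⟩ := ih (fun o ho => h o (List.mem_cons_of_mem _ ho))
    cases o with
    | none => exact absurd rfl (h none (by simp))
    | some c => exact ⟨c :: y, rfl⟩

/-- The dead state of `pairFST` is absorbing. [folklore] -/
theorem pairFST_run_dead (v : List (Option Bool)) : ((pairFST tbl).run .dead v).1 = .dead := by
  induction v with
  | nil => rfl
  | cons o v ih => cases o <;> simpa [FST.run_cons, pairStep] using ih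

/-- from the `y`-states, surviving (not `dead`) means no further separator [folklore] -/
theorem pairFST_noSep (v : List (Option Bool)) :
    ∀ s, (s = .yb ∨ s = .ysn ∨ ∃ ox, s = .ys ox) → ((pairFST tbl).run s v).1 ≠ .dead →
      ∀ o ∈ v, o ≠ none := by
  induction v with
  | nil => intros; simp_all
  | cons o v ih =>
    intro s hs hd
    cases o with
    | none =>
      exfalso; apply hd
      rcases hs with rfl | rfl | ⟨ox, rfl⟩ <;> simp [FST.run_cons, pairStep, pairFST_run_dead]
    | some c =>
      intro o ho
      rcases List.mem_cons.1 ho with rfl | ho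
      · simp
      · rw [FST.run_cons] at hd
        rcases hs with rfl | rfl | ⟨ox, rfl⟩
        · exact ih .yb (Or.inl rfl) (by simpa [pairStep] using hd) o ho
        · exact ih .ysn (Or.inr (Or.inl rfl)) (by simpa [pairStep] using hd) o ho
        · exact ih .ysn (Or.inr (Or.inl rfl)) (by simpa [pairStep] using hd) o ho

/-- from the `x`-states, ending in a `y`-state means the word was a `pairWord` [folklore] -/
theorem pairFST_good (v : List (Option Bool)) :
    ∀ s, (s = .x0 ∨ s = .xn ∨ ∃ a, s = .x1 a) →
      (((pairFST tbl).run s v).1 = .yb ∨ ∃ ox, ((pairFST tbl).run s v).1 = .ys ox) →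
      ∃ x y, v = pairWord x y := by
  induction v with
  | nil =>
    intro s hs hg
    rcases hs with rfl | rfl | ⟨a, rfl⟩ <;> simp at hg
  | cons o v ih =>
    intro s hs hg
    cases o with
    | some a =>
      rw [FST.run_cons] at hg
      have hs' : (pairStep s (some a)).1 = .x0 ∨ (pairStep s (some a)).1 = .xn ∨
          ∃ b, (pairStep s (some a)).1 = .x1 b := by
        rcases hs with rfl | rfl | ⟨a', rfl⟩ <;> simp [pairStep]
      obtain ⟨x, y, rfl⟩ := ih _ hs' (by simpa using hg)
      exact ⟨a :: x, y, by simp [pairWord]⟩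
    | none =>
      rw [FST.run_cons] at hg
      have hs' : (pairStep s none).1 = .yb ∨ (pairStep s none).1 = .ysn ∨
          ∃ ox, (pairStep s none).1 = .ys ox := by
        rcases hs with rfl | rfl | ⟨a', rfl⟩ <;> simp [pairStep]
      have hd : ((pairFST tbl).run (pairStep s none).1 v).1 ≠ .dead := by
        intro hd
        simp only [pairFST_step] at hg
        rw [hd] at hg
        simp at hg
      obtain ⟨y, rfl⟩ := exists_map_some_of_forall (pairFST_noSep tbl v _ hs' hd)
      exact ⟨[], y, by simp [pairWord]⟩

/-- Dichotomy for `pairFST`: `pairWord` inputs, or output `[false, false]`. [folklore] -/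
theorem pairFST_eval_dichotomy (u : List (Option Bool)) :
    (∃ x y, u = pairWord x y) ∨ (pairFST tbl).eval u = [false, false] := by
  by_cases hg : ((pairFST tbl).run .x0 u).1 = .yb ∨ ∃ ox, ((pairFST tbl).run .x0 u).1 = .ys ox
  · exact Or.inl (pairFST_good tbl u .x0 (Or.inl rfl) hg)
  · right
    push Not at hg
    obtain ⟨h1, h2⟩ := hg
    simp only [FST.eval, pairFST_init, pairFST_keep, pairFST_front, h1, decide_false]
    generalize ((pairFST tbl).run .x0 u).1 = s at h1 h2
    cases s <;> simp_all [pairFront]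

/-- The transducer `pairFST` computes the flag presentation of `sSmall` (on all words). [folklore] -/
theorem flagEncode_sSmall (u : List (Option Bool)) :
    flagEncode (Function.uncurry boolPair) (sSmall tbl u) = (pairFST tbl).eval u := by
  by_cases h : ∃ x y, u = pairWord x y
  · obtain ⟨x, y, rfl⟩ := h
    rw [sSmall_pairWord]
    split
    · rw [pairFST_eval_small tbl x y ‹_›]; rfl
    · rw [pairFST_eval_big tbl x y (by omega)]; rfl
  · rw [sSmall_of_not tbl u h, (pairFST_eval_dichotomy tbl u).resolve_left h]; rfl

/-- Truncation of the certificate to the allowed length: `(x, y) ↦ (x, y ↾ p(|x|))`. [folklore] -/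
noncomputable def truncP (p : Polynomial ℕ) (q : List Bool × List Bool) : List Bool × List Bool :=
  (q.1, q.2.take (p.eval q.1.length))

/-- **Truncation is polynomial-time on `boolPair`-coded pairs** — the tree's coin-truncation
machine (`CoinTruncation.lean`: `truncSndFn p ∈ FP`, `polyTimeComputable_boolPair_take_holds`;
Arora–Barak 2009, §1.3: polynomials are time-constructible). [folklore] -/
theorem polyTimeComputable_truncP (p : Polynomial ℕ) :
    PolyTimeComputable (Function.uncurry boolPair) (Function.uncurry boolPair) (truncP p) :=
  polyTimeComputable_boolPair_take_holds p

/-- The decider of the checking relation, as a function: parse and flag (`sSmall`), then —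
on the payload `(x, y)` — truncate `y` to length `p(|x|)` and ask the decider of `L'`. [folklore] -/
noncomputable def relDecider (L' : Language Bool) (p : Polynomial ℕ) (u : List (Option Bool)) :
    Bool :=
  Sum.elim id ((L'.boolIndicator ∘ Function.uncurry boolPair) ∘ truncP p) (sSmall tbl u)

/-- The checking-relation decider is polynomial-time: transducer, then `flagElim` of
(truncation, then the decider of `L'`), composed with `PolyTimeComputable.comp_holds`.
[folklore] -/
theorem polyTimeComputable_relDecider {L' : Language Bool}
    (hχ : PolyTimeComputable (id : List Bool → List Bool) encodeBool L'.boolIndicator)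
    (p : Polynomial ℕ) :
    PolyTimeComputable (id : List (Option Bool) → List (Option Bool)) encodeBool
      (relDecider tbl L' p) := by
  have h1 : PolyTimeComputable (id : List (Option Bool) → List (Option Bool))
      (flagEncode (Function.uncurry boolPair)) (sSmall tbl) :=
    (FST.polyTimeComputable_eval (pairFST tbl)).of_output_eq (fun u => flagEncode_sSmall tbl u)
  have h2 : PolyTimeComputable (Function.uncurry boolPair) encodeBool
      ((L'.boolIndicator ∘ Function.uncurry boolPair) ∘ truncP p) :=
    PolyTimeComputable.comp_holds (hχ.precomp (Function.uncurry boolPair))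
      (polyTimeComputable_truncP p)
  exact PolyTimeComputable.comp_holds (h2.flagElim id) h1

/-- The decider on a `pairWord x y`: the hard-wired table for `|x| ≤ 1`, else membership of
`boolPair x (y ↾ p |x|)` in `L'`. [folklore] -/
theorem relDecider_pairWord (L' : Language Bool) (p : Polynomial ℕ) (x y : List Bool) :
    relDecider tbl L' p (pairWord x y) =
      if x.length ≤ 1 then tbl x && y.isEmpty
      else L'.boolIndicator (boolPair x (y.take (p.eval x.length))) := by
  simp only [relDecider, sSmall_pairWord]
  split
  · rfl
  · rfl

/-- The decider rejects malformed words. [folklore] -/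
theorem relDecider_of_not (L' : Language Bool) (p : Polynomial ℕ) (u : List (Option Bool))
    (hu : ¬ ∃ x y, u = pairWord x y) : relDecider tbl L' p u = false := by
  simp [relDecider, sSmall_of_not tbl u hu]

end Converse

/-- `polyExists P` over `{0,1}` (Arora–Barak 2009, Def. 2.1) is contained in Cook's
checking-relation `NP` over `{0,1,#}` (Cook, Clay problem description §1).
[cite: AroraBarakCC2009, Def. 2.1 (book p. 39)] -/
theorem NP_subset_NP_bool : Nondeterministic.NP ⊆ Literature.Computability.Complexity.PNPWave0.NP Bool := by
  classical
  rintro L ⟨L', hL'P, p, hL⟩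
  have hχ : PolyTimeComputable (id : List Bool → List Bool) encodeBool L'.boolIndicator :=
    polyTimeDecidable_iff.1 (mem_P_iff_holds.1 hL'P)
  obtain ⟨k, hk1, hk⟩ := exists_pow_dominates p
  let tbl : List Bool → Bool := fun x => decide (x ∈ L)
  let R : List Bool → List Bool → Prop := fun x y =>
    if x.length ≤ 1 then y = [] ∧ x ∈ L else boolPair x (y.take (p.eval x.length)) ∈ L'
  refine ⟨k, R, ⟨relDecider tbl L' p, ?_, ?_⟩, ?_⟩
  · rw [isPolyTimePred_iff]
    exact polyTimeComputable_relDecider tbl hχ p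
  · intro u
    constructor
    · rintro ⟨x, y, rfl, hR⟩
      rw [relDecider_pairWord]
      simp only [R] at hR
      split
      · rw [if_pos ‹_›] at hR
        obtain ⟨rfl, hx⟩ := hR
        simp [tbl, hx]
      · rw [if_neg ‹_›] at hR
        exact (Set.mem_iff_boolIndicator _ _).1 hR
    · intro hu
      by_cases h : ∃ x y, u = pairWord x y
      · obtain ⟨x, y, rfl⟩ := h
        refine ⟨x, y, rfl, ?_⟩
        rw [relDecider_pairWord] at hu
        simp only [R]
        split
        · rw [if_pos ‹_›] at hu
          simp only [Bool.and_eq_true, decide_eq_true_eq, List.isEmpty_iff, tbl] at hu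
          exact ⟨hu.2, hu.1⟩
        · rw [if_neg ‹_›] at hu
          exact (Set.mem_iff_boolIndicator _ _).2 hu
      · rw [relDecider_of_not tbl L' p u h] at hu
        exact absurd hu (by simp)
  · intro x
    rw [hL x]
    simp only [R]
    split
    · constructor
      · rintro ⟨y, hyl, hy⟩
        exact ⟨[], by simp, rfl, (hL x).2 ⟨y, hyl, hy⟩⟩
      · rintro ⟨y, -, rfl, hx⟩
        exact (hL x).1 hx
    · constructor
      · rintro ⟨y, hy, hy'⟩
        exact ⟨y, hy.trans (hk _ (by omega)), by rwa [List.take_of_length_le hy]⟩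
      · rintro ⟨y, -, hy⟩
        exact ⟨y.take (p.eval x.length), List.length_take_le _ _, hy⟩

/-- **The model bridge**: Cook's checking-relation `NP` over `{0,1,#}` (`Literature.PNP.NP Bool`;
Cook, Clay problem description §1) equals `CplxCore.NP = polyExists P` over `{0,1}`
(Arora–Barak 2009, Def. 2.1: `x ∈ L ⇔ ∃ u ∈ {0,1}^{p(|x|)}, M(x,u) = 1`). The sources give the
two definitions; the equality is the folklore robustness of the model (Arora–Barak §1.2–1.3,
Claims 1.5–1.6), proved here on Mathlib's `Turing.TM2`.
[cite: AroraBarakCC2009, Def. 2.1 (book p. 39) and §1.2–1.3] -/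
theorem np_bool_eq : Literature.Computability.Complexity.PNPWave0.NP Bool = Nondeterministic.NP :=
  Set.Subset.antisymm NP_bool_subset NP_subset_NP_bool

end Literature.Computability.Complexity
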